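import Summits.Parity.GeneralizedHardyLittlewood.Theses.ZDegreeToeplitzBand
import Literature.NumberTheory.LFunctions.Zhang2022.Section8ProfileSjPoly

/-!
# Route `ZDegreeToeplitzBand` — item stmt-Parity-22437 `InClassSideTablesPoly` (the re-posed K0, binder `h0′` of `closes`):
# Zhang's side-table dictionary on POLYNOMIAL SHORT PIECES, for all large `c′` — CLOSED by a kernel theorem

`InClassSideTablesPoly := ∃ c₀, ∀ c′ ≥ c₀, KnifeEdge.InClassMeanPoly c′` — for every polynomial short piece `u` of length
`θ < 1` and every `ε > 0`, eventually in `D` under (A),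
`|discMean c′ χ (profPoly χ · u (⌊P⌋+1)) − mainTermForm u u′·𝔞𝔓| ≤ ε𝔞𝔓`. This is the Literature theorem
`DipoleRule.inClassMeanPoly_eventually` (p558282, `Zhang2022/Section8ProfileSjPoly`; chain p549083 … p557827 of the
prover seat ls-knife-K0-p1, line «sjrows»: Prop 7.1's `S_j` for profile data — exact form, LEMMA A / LEMMA A* pointwise rows,
sliver, (8.10), range engine, jets — on top of the tree theorems Prop 7.1 `prop71X_holds`, Lemma 8.1, Prop 2.2(i), Lemma 2.3,
Lemma 8.2 `lemma82_holds`, Lemmas 8.3/8.4 `lemma84Rel_holds`). The wider kernel classes (all `C²` short pieces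
`sjProfileRow_C2`; finite sums of `C²` short pieces = kinked pieces, `Section8ProfileSjSum`) land `--supports` the declared
crux stmt-Parity-20459. **Not a claim about Theorems 1–2 of arXiv:2211.02515 or about Landau–Siegel zeros; the programme
SEARCHES and TYPES.** [cite: Zhang2022LandauSiegel, §7 Prop 7.1, §8 Lemma 8.1, (8.23)]

Prover: ls-knife-K0-p1 g3 (cell landau-siegel §D, CHAIN #1 toeplitz closure squad, K0).
-/

namespace Summit.Parity.GeneralizedHardyLittlewood.Theorems

/-- **K0 ON POLYNOMIAL SHORT PIECES (stmt-Parity-22437) HOLDS:** `∃ c₀, ∀ c′ ≥ c₀, KnifeEdge.InClassMeanPoly c′` — the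
Literature theorem `DipoleRule.inClassMeanPoly_eventually`, token for token. [cite: Zhang2022LandauSiegel, §7 Prop 7.1, §8 (8.23)] -/
theorem inClassSideTablesPoly_proof :
    Summit.Parity.GeneralizedHardyLittlewood.Theses.ZDegreeToeplitzBand.InClassSideTablesPoly :=
  Literature.NumberTheory.LFunctions.Zhang2022.DipoleRule.inClassMeanPoly_eventually

end Summit.Parity.GeneralizedHardyLittlewood.Theorems
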